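import Summits.QuantumFields.BalabanUV.T4Continuum.Spine.NE1p.DressedSmallFieldFamilyCount

/-!
# T⁴ programme, spine estimate NE1′ (node O3b/H2) — (B3-amp) FOR LETTERS OF (2.18)-FORM IS PRINT's (2.28) ARITHMETIC: the per-family
# amplitude clause `hAmp` of N0s's families END SUPPLIED from a letter product of the form `Gc(Z)·Π_{Y∈𝐃} θ·e^{−(1−3δ)κ d_k(Y)}`
# (one τ-radius letter per polymer of the Mayer subfamily, amplitude `θ` read at the DRESSED table level) under the rate clause
# `R + δκ ≤ (1−3δ)κ` and the p. 18 clause `θ·e^{5R} ≤ α₆` — what stays displayed of (B3) is the FORM of the letters and ARITHMETIC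

Cell `pub-balaban`, sub-cell `t4`, BINDER-OWNERS row NE1′; owner lineage t4-ne1p-p1 (PROVER seat P1, «RG-trajectory comparison …
μ-uniformity through the printed small-field bounds»), generation 29; ADDITIVE — imports the owner's N0s
`Spine/NE1p/DressedSmallFieldFamilyCount` ONLY (→ N0r p228506 → N0q → N0p; b13's `B13FamilySum` in the cone); THEOREMS ONLY (0 def,
0 `def … : Prop`, 0 cite); nothing of N0s ∕ N0r ∕ b13's modules is restated — used BY NAME.

WHY THIS FILE.  N0s split the bracket's (B3) into a TABLE-BLIND COUNT (μ-free by construction; for the 𝐃-step supplied from the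
(2.11)-geometry one scale down) and ONE per-term AMPLITUDE clause `hAmp : letters(Z, 𝐃) ≤ (A₀ + ϱA₁)·Π_{Y∈𝐃} α₆e^{−δκ d_k(Y)}·
e^{−R(d_k(Y)+5)}`, and located the dressing there.  Print obtains exactly this shape by ARITHMETIC, (2.28) p. 18: from the per-term
bound (2.26) — one τ-radius letter `2∕|τ(Y)| = 2E₀ε₁C₁α₄⁻¹M^q e^{C₂κ₁}·e^{−(1−3δ)κ d_k(Y)}` per polymer `Y ∈ 𝐃` ((2.18) p. 16) — «We
extract the expression α₆exp(−δκd_k(Y)) from each factor in it» and «Assuming 2E₀ε₁C₁α₄⁻¹α₆⁻¹M^q exp C₂κ₁ exp 5κ ≤ 1, we have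
Π_{Y∈𝐃}(…in (2.26)) ≤ Π_{Y∈𝐃} α₆exp(−δκd_k(Y)) · 2E₀ε₁C₁α₄⁻¹α₆⁻¹M^q exp C₂κ₁ exp(−(1−4δ)κd_k(Y₀))».  Here, with `θ` standing for the
per-polymer amplitude of the radius letter (print's `2E₀ε₁C₁α₄⁻¹M^q e^{C₂κ₁}`; for the DRESSED table read at the dressed level — the
cell's `C₃(E₀ + D₀)` wording — this is WHERE the observable ∕ the source window enters (B3)):
* §1 `radiusLetter_le` [arith]: `θe^{−(1−3δ)κd} ≤ (α₆e^{−δκd}·e^{−R(d+5)})·(θα₆⁻¹e^{5R})` for `d ≥ 0`, `R + δκ ≤ (1−3δ)κ`.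
* §2 `prod_radiusLetters_le` [arith]: for a NONEMPTY family, under the p. 18 clause `θe^{5R} ≤ α₆` (so the per-polymer amplitude
  `θα₆⁻¹e^{5R} ≤ 1` and all but one such factor are dropped): `Π_{Y∈𝐃} θe^{−(1−3δ)κ d_k Y} ≤ (θα₆⁻¹e^{5R})·Π_{Y∈𝐃} α₆e^{−δκ d_k Y}·
  e^{−R(d_k Y+5)}` — (2.28) with its decay bookkept PER MEMBER ((2.27) is then N0s's `prod_family_le`).  The b13 sub-cell's
  `B13.prod_bound_228` certifies the same printed passage in the COMBINED form `Π_{Y} A e^{−r d_k Y} ≤ A e^{−r d_k(Y₀)}` ((2.27)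
  consumed inside); the member-wise form here is what the amplitude × count split of N0s needs — a different statement, nothing
  of b13's restated.
* §3 `nonempty_of_mem_coveringFamilies` (a family covering a nonempty footprint is nonempty), the source-pencil twin of N0s §4
  `muPart_locE_le_of_coresAt_pencil_families` (N0s's `muPart_locE_le_of_coresAt_pencil_count` + `count_coveringFamilies_geometry` BY NAME:
  the observable's table contribution `v` scaled by the source enters ONLY `hAmp`, the count is μ-free), and the END
  **`attachedPart_locE_le_of_coresAt_pencil_radii`** = N0s's `attachedPart_locE_le_of_coresAt_pencil_families` ONCE BY NAME with
  `hAmp` SUPPLIED from: `hform` (the core's letter product ≤ `Gc Z·Π_{Y∈𝐃} θe^{−(1−3δ)κ d_k Y}` — the (2.15)∕(2.18)-FORM of the letters,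
  an IDENTIFICATION, displayed), `hRδ` (rate clause), `hclause` (p. 18 clause at the dressed `θ`), `hamp` (`Gc Z·θα₆⁻¹e^{5R} ≤ A₀ + ϱA₁`,
  bookkeeping against N0m's pencil constants).  Count, geometry, cores, pencil, KP clauses VERBATIM N0s §4's.

WHAT THIS DOES TO THE WALL (owner's reading; nothing re-labelled here; offered to the dagwriter with Q47).  After N0s + this file the
small-field bracket's (B3) reads, for activities built from (2.14)-cores indexed by Mayer subfamilies: (B3-count) TABLE-BLIND, printed
KIND, 𝐃-step tree-proved (N0s) ∧ (B3-form) the letters of each core have the (2.15)∕(2.18)-FORM `Gc(Z)·Π_{Y∈𝐃} θe^{−(1−3δ)κd_k(Y)}`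
with `Gc(Z)` collecting rows NE2∕NE3's Gaussian letters, the flat dimension and the read-out growth `e^{N₁R₀}` (the «size half»,
annotation (ii): in print `|τ(Y)|·|V_k(Y,B)|` is controlled by (2.19)∕(2.20) inside the Gaussian integral — here it is the letter `N₁`
times the dressed radius, to be absorbed in `Gc` or in `θ`; an IDENTIFICATION of the cell's letters with print's, READING) ∧ (B3-arith)
the two clauses `R + δκ ≤ (1−3δ)κ`, `θe^{5R} ≤ α₆` at the DRESSED `θ` + `Gc(Z)·θα₆⁻¹e^{5R} ≤ A₀ + ϱA₁` — (B5)-KIND arithmetic (print's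
«ε₁ sufficiently small» read at `C₃(E₀+D₀)`; no absolute floor, C-t4r2-364).  So the bracket's «UNPRINTED for other tables» content of
(B3) is LOCATED in the FORM identification and the remaining resummation steps (Y₀∕P, Z₀, Z′₀ — printed KIND, not composed); NOTHING of it
is discharged on Bałaban's densities; 0 binders instantiated on Bałaban's (2.14) data; wall v1.7 does NOT move; NE1′ NOT printed, NOT
proved; 0∕9; count 9 unchanged.

HONEST FRAMING.  Real arithmetic ([arith]) + one by-name application of N0s's END; [Balaban1988RGII] (2.18) p. 16, (2.26) p. 17,
(2.27)∕(2.28)∕(2.29) p. 18 are LOCI of the audited manuscript (renders `…-p016∕p017∕p018-x2.png` read as images this generation),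
TYPE∕CONTEXT only, never hypothesis-free facts; ABSOLUTE RULE honoured; nothing internally minted is cited.  Rung (B)+1 on ONE finite T⁴ —
NOT infinite volume, NOT a mass gap, NOT OS on ℝ⁴, NOT Clay.  HONEST DEPENDENCY: continuum YM on T⁴ ⇐ BetaPertH ∧ nine spine estimates
(0/9 proved); BetaPertH ⇐ (D1) ∧ (D4) ∧ CAP+tail; G-an2-4 gates asym, D1 and NE2/3/4. -/
noncomputable section

namespace Summit.QuantumFields.BalabanUV.T4Continuum.NE1p.DressedSmallFieldFamilyAmplitude

open Metric Set Complex MeasureTheory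
open scoped BigOperators
open Literature.MathematicalPhysics.QuantumFieldTheory.Balaban1983to89 (LocDomainSys)
open Literature.MathematicalPhysics.QuantumFieldTheory.Balaban1983to89.T4OutputRate (Carriers)
open Literature.MathematicalPhysics.QuantumFieldTheory.Balaban1983to89.B13Resummation (locE Geometry)
open Literature.MathematicalPhysics.QuantumFieldTheory.Balaban1983to89.B13FamilySum (coveringFamilies mem_coveringFamilies)
open Summit.QuantumFields.BalabanUV.T4Continuum.B13HistMeasurable (MeasPotFrame B13HistM)
open Summit.QuantumFields.BalabanUV.T4Continuum.B13TermParamGaussianBi (BiCore)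
open Summit.QuantumFields.BalabanUV.T4Continuum.NE1p.DressedSmallFieldFamilyCount
  (attachedPart_locE_le_of_coresAt_pencil_families muPart_locE_le_of_coresAt_pencil_count count_coveringFamilies_geometry)

/-! ## §1 (2.28) PER POLYMER: extracting `α₆e^{−δκ d}·e^{−R(d+5)}` from the τ-radius letter `θ·e^{−(1−3δ)κ d}` -/

section PerPolymer

/-- **(2.28) PER POLYMER** [arith]: for `d ≥ 0`, `0 < α₆`, `0 ≤ θ` and the rate clause `R + δκ ≤ (1−3δ)κ` (print: `R = (1−4δ)κ`),
`θ·e^{−(1−3δ)κ d} ≤ (α₆·e^{−δκ d}·e^{−R(d+5)}) · (θ·α₆⁻¹·e^{5R})` — the τ-radius letter of ONE polymer of the family pays the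
table-blind majorant's factor, the remainder `θα₆⁻¹e^{5R}` is the per-polymer AMPLITUDE ((2.28) p. 18, TYPE). -/
theorem radiusLetter_le {θ α₆ δ κ R d : ℝ} (hθ : 0 ≤ θ) (hα₆ : 0 < α₆) (hd : 0 ≤ d) (hR : R + δ * κ ≤ (1 - 3 * δ) * κ) :
    θ * Real.exp (-((1 - 3 * δ) * κ * d)) ≤
      (α₆ * Real.exp (-(δ * κ * d)) * Real.exp (-(R * (d + 5)))) * (θ * α₆⁻¹ * Real.exp (5 * R)) := by
  have hexp : Real.exp (-((1 - 3 * δ) * κ * d)) ≤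
      Real.exp (-(δ * κ * d)) * Real.exp (-(R * (d + 5))) * Real.exp (5 * R) := by
    rw [← Real.exp_add, ← Real.exp_add]
    exact Real.exp_le_exp.2 (by nlinarith)
  calc θ * Real.exp (-((1 - 3 * δ) * κ * d))
      ≤ θ * (Real.exp (-(δ * κ * d)) * Real.exp (-(R * (d + 5))) * Real.exp (5 * R)) :=
        mul_le_mul_of_nonneg_left hexp hθ
    _ = (α₆ * Real.exp (-(δ * κ * d)) * Real.exp (-(R * (d + 5)))) * (θ * α₆⁻¹ * Real.exp (5 * R)) := by
        field_simp

end PerPolymer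

/-! ## §2 (2.28) FOR A FAMILY: the product of the radius letters over a NONEMPTY family under the p. 18 clause `θe^{5R} ≤ α₆` -/

section Family

variable {DomK : Type*}

/-- **(2.28) FOR A NONEMPTY FAMILY** [arith]: under the rate clause `R + δκ ≤ (1−3δ)κ`, `0 ≤ R`, and the p. 18 clause
`θ·e^{5R} ≤ α₆` (print: «Assuming 2E₀ε₁C₁α₄⁻¹α₆⁻¹M^q exp C₂κ₁ exp 5κ ≤ 1», TYPE — here `θ` is the per-polymer amplitude of the
τ-radius letter read at the DRESSED level), for a nonempty family `𝐃` with sizes `d_k ≥ 0`: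
`Π_{Y∈𝐃} θ·e^{−(1−3δ)κ d_k Y} ≤ (θ·α₆⁻¹·e^{5R}) · Π_{Y∈𝐃} α₆e^{−δκ d_k Y}·e^{−R(d_k Y + 5)}` — ONE amplitude factor survives
(`≤ 1`-factors of the other members dropped). -/
theorem prod_radiusLetters_le (Df : Finset DomK) (hne : Df.Nonempty) (dK : DomK → ℝ) {θ α₆ δ κ R : ℝ} (hθ : 0 ≤ θ)
    (hα₆ : 0 < α₆) (hd : ∀ Y ∈ Df, 0 ≤ dK Y) (hR : R + δ * κ ≤ (1 - 3 * δ) * κ)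
    (hclause : θ * Real.exp (5 * R) ≤ α₆) :
    ∏ Y ∈ Df, θ * Real.exp (-((1 - 3 * δ) * κ * dK Y)) ≤
      (θ * α₆⁻¹ * Real.exp (5 * R)) * ∏ Y ∈ Df, (α₆ * Real.exp (-(δ * κ * dK Y)) * Real.exp (-(R * (dK Y + 5)))) := by
  classical
  have hamp1 : θ * α₆⁻¹ * Real.exp (5 * R) ≤ 1 := by
    rw [mul_right_comm, mul_inv_le_iff₀ hα₆, one_mul]; exact hclause
  have hamp0 : 0 ≤ θ * α₆⁻¹ * Real.exp (5 * R) := by positivity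
  -- termwise (2.28), then collect the amplitude factors
  have hstep : ∏ Y ∈ Df, θ * Real.exp (-((1 - 3 * δ) * κ * dK Y)) ≤
      ∏ Y ∈ Df, ((α₆ * Real.exp (-(δ * κ * dK Y)) * Real.exp (-(R * (dK Y + 5)))) * (θ * α₆⁻¹ * Real.exp (5 * R))) :=
    Finset.prod_le_prod (fun Y _ => by positivity) fun Y hY => radiusLetter_le hθ hα₆ (hd Y hY) hR
  refine hstep.trans ?_
  rw [Finset.prod_mul_distrib, Finset.prod_const, mul_comm]
  refine mul_le_mul_of_nonneg_right ?_ (Finset.prod_nonneg fun Y _ => by positivity)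
  -- (amp)^{#𝐃} ≤ amp for 0 ≤ amp ≤ 1 and #𝐃 ≥ 1
  obtain ⟨n, hn⟩ : ∃ n, Df.card = n + 1 := ⟨Df.card - 1, (Nat.sub_add_cancel (Finset.card_pos.2 hne)).symm⟩
  rw [hn, pow_succ]
  exact mul_le_of_le_one_left hamp0 (pow_le_one₀ hamp0 hamp1)

end Family

/-! ## §3 THE FAMILIES END WITH (B3-amp) SUPPLIED FROM LETTERS OF (2.18)-FORM -/

section End

variable {C : Carriers} {P : MeasPotFrame C} {Op : Type*} [NormedAddCommGroup Op] [NormedSpace ℂ Op] {Dk : LocDomainSys}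
  {𝒴 : ℕ → Finset Dk.Dom → Type*} {dom : ∀ k i, 𝒴 k i → C.Dom} {β : ℕ → Finset Dk.Dom → Type*}
  [∀ k i, MeasurableSpace (β k i)] {α : ℕ → Finset Dk.Dom → Type*} [∀ k i, NormedAddCommGroup (α k i)]
  [∀ k i, InnerProductSpace ℝ (α k i)] [∀ k i, FiniteDimensional ℝ (α k i)] [∀ k i, MeasurableSpace (α k i)]
  [∀ k i, BorelSpace (α k i)]
variable (D : LocDomainSys) {Cube : Type} [DecidableEq Cube] (G : Geometry D Cube) {CubeK : Type} [DecidableEq CubeK]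
  (Gk : Geometry Dk CubeK)

/-- A family covering a NONEMPTY footprint is nonempty. [folklore] -/
theorem nonempty_of_mem_coveringFamilies {S : Finset Dk.Dom} {cubesK : Dk.Dom → Finset CubeK} {Y₀ : Finset CubeK}
    (hY₀ : Y₀.Nonempty) {Df : Finset Dk.Dom} (h : Df ∈ coveringFamilies S cubesK Y₀) : Df.Nonempty := by
  obtain ⟨-, hU⟩ := mem_coveringFamilies.1 h
  rw [Finset.nonempty_iff_ne_empty]
  rintro rfl
  rw [Finset.biUnion_empty] at hU
  exact hY₀.ne_empty hU.symm

open Classical in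
/-- **THE μ-PART (SOURCE PENCIL `h₀ + s • v`, `‖s‖ < μ₁`) FOR CORES INDEXED BY COVERING FAMILIES, (B3)'s COUNT DISCHARGED** (kernel;
N0s's `muPart_locE_le_of_coresAt_pencil_count` ONCE BY NAME at the term index `Finset Dk.Dom` with the table-blind majorant
`Π_{Y∈𝐃} α₆e^{−δκ d_k(Y)}·e^{−R(d_k(Y)+5)}` and `hCount` SUPPLIED by N0s's `count_coveringFamilies_geometry` (`R ≥ 0` from `hrate`) —
the source-pencil twin of N0s §4, which N0s leaves to the reader: the observable's table contribution `v` scaled by the source `s`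
enters ONLY the per-family amplitude clause `hAmp` (through the radius `‖h₀‖ + μ₁‖v‖`), the count is μ-free).  For `0 < μ₀ < μ₁`,
`‖sμ‖ ≤ μ₀`: `‖E[act sμ](X₀) − E[act 0](X₀)‖ ≤ (e ν c₁ K₀²·A·e^{−r₁ d(X₀)})·μ₀∕(μ₁ − μ₀)`. [folklore] -/
theorem muPart_locE_le_of_coresAt_pencil_families {W : Set (ℕ → ℝ)}
    {ctr : ℕ → (ℕ → ℝ) → C.BgB → Op × B13HistM P} {ROp RHist R' : ℕ → ℝ}
    (𝔊 : ∀ k i, C.Dom → BiCore P (dom k i) Op (β k i) (α k i)) {mq bq N₀ : ℕ → Finset Dk.Dom → C.Dom → ℝ}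
    (hroom : ∀ k, ROp k < R' k)
    (hm : ∀ k, ∀ g ∈ W, ∀ (U : C.BgB) (X : C.Dom), C.scale X = k → ∀ i, 0 < mq k i X)
    (hN : ∀ k, ∀ g ∈ W, ∀ (U : C.BgB) (X : C.Dom), C.scale X = k → ∀ i,
      (∀ o ∈ ball (ctr k g U).1 (R' k), AEStronglyMeasurable ((𝔊 k i X).N o) (𝔊 k i X).lam) ∧
      (∀ p, DifferentiableOn ℂ (fun o => (𝔊 k i X).N o p) (ball (ctr k g U).1 (R' k))) ∧
      (∀ o ∈ ball (ctr k g U).1 (R' k), ∀ p, ‖(𝔊 k i X).N o p‖ ≤ N₀ k i X))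
    (hq : ∀ k, ∀ g ∈ W, ∀ (U : C.BgB) (X : C.Dom), C.scale X = k → ∀ i,
      (∀ o ∈ ball (ctr k g U).1 (R' k),
        AEStronglyMeasurable (Function.uncurry ((𝔊 k i X).q o)) ((𝔊 k i X).lam.prod volume)) ∧
      (∀ p v, DifferentiableOn ℂ (fun o => (𝔊 k i X).q o p v) (ball (ctr k g U).1 (R' k))) ∧
      (∀ o ∈ ball (ctr k g U).1 (R' k), ∀ p v, mq k i X * ‖v‖ ^ 2 - bq k i X ≤ ((𝔊 k i X).q o p v).re))
    {k : ℕ} {g : ℕ → ℝ} (hg : g ∈ W) {U : C.BgB} {o : Op} {h₀ v : B13HistM P} {μ₁ : ℝ}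
    (hO : ‖o - (ctr k g U).1‖ ≤ ROp k) (hH : ‖h₀ - (ctr k g U).2‖ + μ₁ * ‖v‖ ≤ RHist k)
    {emb : D.Dom → C.Dom} (hscale : ∀ Z, C.scale (emb Z) = k) {terms : D.Dom → Finset (Finset Dk.Dom)}
    {act : ℂ → D.Dom → ℂ}
    (hact : ∀ s ∈ ball (0 : ℂ) μ₁, ∀ Z, act s Z = ∑ i ∈ terms Z, (𝔊 k i (emb Z)).termAt o (h₀ + s • v))
    {A R r₁ b₅ μ₀ : ℝ} {X₀ : D.Dom} {sμ : ℂ} (hA : 0 ≤ A) (hr₁ : 0 ≤ r₁) (hb : r₁ * 5 ≤ b₅)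
    (hrate : r₁ + 2 * G.κ₀ + 2 ≤ R) (hsmall : A * Real.exp (b₅ + 1) * G.K₀ * G.ν * G.c₁ ≤ 1)
    (foot : D.Dom → Dk.Dom) (hmono : ∀ Z, D.dj Z ≤ Dk.dj (foot Z)) {δ κ α₆ : ℝ} (hα₆ : 0 ≤ α₆)
    (hκ : Gk.κ₀ + 1 ≤ δ * κ) (h229 : Real.exp 1 * Gk.K₀ * Gk.c₁ * α₆ ≤ 1)
    (hterms : ∀ Z, terms Z ⊆ coveringFamilies Finset.univ Gk.cubes (Gk.cubes (foot Z)))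
    (hAmp : ∀ Z, G.cubes Z ⊆ G.cubes X₀ → ∀ Df ∈ terms Z,
      (𝔊 k Df (emb Z)).lam.real univ * ((𝔊 k Df (emb Z)).wB * N₀ k Df (emb Z) * Real.exp (bq k Df (emb Z))) *
          (Real.pi / (mq k Df (emb Z) / 2)) ^ (Module.finrank ℝ (α k Df) / 2 : ℝ) *
        Real.exp ((𝔊 k Df (emb Z)).N₁ * (‖h₀‖ + μ₁ * ‖v‖)) ≤
      A * ∏ Y ∈ Df, (α₆ * Real.exp (-(δ * κ * Dk.dj Y)) * Real.exp (-(R * (Dk.dj Y + 5)))))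
    (h0 : 0 < μ₀) (h01 : μ₀ < μ₁) (hμ : ‖sμ‖ ≤ μ₀) :
    ‖locE G.ι G.cubes (act sμ) (G.cubes X₀) - locE G.ι G.cubes (act 0) (G.cubes X₀)‖ ≤
      Real.exp 1 * G.ν * G.c₁ * G.K₀ ^ 2 * A * Real.exp (-(r₁ * D.dj X₀)) * (μ₀ / (μ₁ - μ₀)) :=
  have hR : 0 ≤ R := by linarith [G.κ₀_nonneg]
  muPart_locE_le_of_coresAt_pencil_count D G 𝔊 hroom hm hN hq hg hO hH hscale hact hA hr₁ hb hrate hsmall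
    (fun _ Df => ∏ Y ∈ Df, (α₆ * Real.exp (-(δ * κ * Dk.dj Y)) * Real.exp (-(R * (Dk.dj Y + 5))))) hAmp
    (fun Z _ => count_coveringFamilies_geometry Gk foot hmono hα₆ hκ h229 hR Z (hterms Z)) h0 h01 hμ

open Classical in
/-- **THE ATTACHED PART FOR CORES INDEXED BY COVERING FAMILIES, (B3) = (2.18)-FORM LETTERS + PRINT's TWO CLAUSES** (kernel; N0s's
`attachedPart_locE_le_of_coresAt_pencil_families` ONCE BY NAME, its per-family amplitude clause `hAmp` SUPPLIED by §2's (2.28)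
arithmetic `prod_radiusLetters_le` from: `hform` — the letter product of the core for `𝐃` (parameter volume × weight letter × rows
NE2∕NE3's Gaussian letters × flat dimension × read-out growth `e^{N₁(‖h₀‖+ϱ‖w‖)}` at the DRESSED table radius) is at most
`Gc Z · Π_{Y∈𝐃} θ·e^{−(1−3δ)κ d_k(Y)}` (the (2.15)∕(2.18)-FORM: one τ-radius letter `2∕|τ(Y)| = θ e^{−(1−3δ)κ d_k(Y)}` per polymer of
the Mayer subfamily, `θ` its amplitude read at the dressed level, `Gc Z` the Gaussian ∕ normalisation constants of the term — an
IDENTIFICATION of the cell's letters with print's form, (B1b)-READING KIND, displayed); the rate clause `R + δκ ≤ (1−3δ)κ` (print: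
`R = (1−4δ)κ`); the p. 18 clause `θ·e^{5R} ≤ α₆` («Assuming 2E₀ε₁C₁α₄⁻¹α₆⁻¹M^q exp C₂κ₁ exp 5κ ≤ 1», TYPE, at the dressed `θ`); and
the amplitude bookkeeping `Gc Z·(θα₆⁻¹e^{5R}) ≤ A₀ + ϱA₁` against N0m's pencil constants.  The count is N0s's (table-blind, from `Gk`);
families are nonempty because they cover the nonempty footprint `Gk.cubes (foot Z)`.  Every other binder VERBATIM N0s §4's.
Conclusion: `‖E[act 1](X₀) − E[act 0](X₀)‖ ≤ 4·(e ν c₁ K₀²)·A₁·e^{−r₁ d(X₀)}`. [folklore] -/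
theorem attachedPart_locE_le_of_coresAt_pencil_radii {W : Set (ℕ → ℝ)}
    {ctr : ℕ → (ℕ → ℝ) → C.BgB → Op × B13HistM P} {ROp RHist R' : ℕ → ℝ}
    (𝔊 : ∀ k i, C.Dom → BiCore P (dom k i) Op (β k i) (α k i)) {mq bq N₀ : ℕ → Finset Dk.Dom → C.Dom → ℝ}
    (hroom : ∀ k, ROp k < R' k)
    (hm : ∀ k, ∀ g ∈ W, ∀ (U : C.BgB) (X : C.Dom), C.scale X = k → ∀ i, 0 < mq k i X)
    (hN : ∀ k, ∀ g ∈ W, ∀ (U : C.BgB) (X : C.Dom), C.scale X = k → ∀ i,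
      (∀ o ∈ ball (ctr k g U).1 (R' k), AEStronglyMeasurable ((𝔊 k i X).N o) (𝔊 k i X).lam) ∧
      (∀ p, DifferentiableOn ℂ (fun o => (𝔊 k i X).N o p) (ball (ctr k g U).1 (R' k))) ∧
      (∀ o ∈ ball (ctr k g U).1 (R' k), ∀ p, ‖(𝔊 k i X).N o p‖ ≤ N₀ k i X))
    (hq : ∀ k, ∀ g ∈ W, ∀ (U : C.BgB) (X : C.Dom), C.scale X = k → ∀ i,
      (∀ o ∈ ball (ctr k g U).1 (R' k),
        AEStronglyMeasurable (Function.uncurry ((𝔊 k i X).q o)) ((𝔊 k i X).lam.prod volume)) ∧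
      (∀ p v, DifferentiableOn ℂ (fun o => (𝔊 k i X).q o p v) (ball (ctr k g U).1 (R' k))) ∧
      (∀ o ∈ ball (ctr k g U).1 (R' k), ∀ p v, mq k i X * ‖v‖ ^ 2 - bq k i X ≤ ((𝔊 k i X).q o p v).re))
    {k : ℕ} {g : ℕ → ℝ} (hg : g ∈ W) {U : C.BgB} {o : Op} {h₀ w : B13HistM P} {ϱ : ℝ}
    (hO : ‖o - (ctr k g U).1‖ ≤ ROp k) (hH : ‖h₀ - (ctr k g U).2‖ + ϱ * ‖w‖ ≤ RHist k)
    {emb : D.Dom → C.Dom} (hscale : ∀ Z, C.scale (emb Z) = k) {terms : D.Dom → Finset (Finset Dk.Dom)}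
    {act : ℂ → D.Dom → ℂ}
    (hact : ∀ s ∈ ball (0 : ℂ) ϱ, ∀ Z, act s Z = ∑ i ∈ terms Z, (𝔊 k i (emb Z)).termAt o (h₀ + s • w))
    {A₀ A₁ R r₁ b₅ : ℝ} {X₀ : D.Dom} (hA₀ : 0 ≤ A₀) (hA₁ : 0 ≤ A₁) (hr₁ : 0 ≤ r₁) (hb : r₁ * 5 ≤ b₅)
    (hrate : r₁ + 2 * G.κ₀ + 2 ≤ R) (hsmall : (A₀ + ϱ * A₁) * Real.exp (b₅ + 1) * G.K₀ * G.ν * G.c₁ ≤ 1)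
    (foot : D.Dom → Dk.Dom) (hmono : ∀ Z, D.dj Z ≤ Dk.dj (foot Z)) {δ κ α₆ θ : ℝ} {Gc : D.Dom → ℝ} (hα₆ : 0 < α₆)
    (hκ : Gk.κ₀ + 1 ≤ δ * κ) (h229 : Real.exp 1 * Gk.K₀ * Gk.c₁ * α₆ ≤ 1)
    (hterms : ∀ Z, terms Z ⊆ coveringFamilies Finset.univ Gk.cubes (Gk.cubes (foot Z)))
    (hθ : 0 ≤ θ) (hGc : ∀ Z, 0 ≤ Gc Z) (hRδ : R + δ * κ ≤ (1 - 3 * δ) * κ) (hclause : θ * Real.exp (5 * R) ≤ α₆)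
    (hamp : ∀ Z, G.cubes Z ⊆ G.cubes X₀ → Gc Z * (θ * α₆⁻¹ * Real.exp (5 * R)) ≤ A₀ + ϱ * A₁)
    (hform : ∀ Z, G.cubes Z ⊆ G.cubes X₀ → ∀ Df ∈ terms Z,
      (𝔊 k Df (emb Z)).lam.real univ * ((𝔊 k Df (emb Z)).wB * N₀ k Df (emb Z) * Real.exp (bq k Df (emb Z))) *
          (Real.pi / (mq k Df (emb Z) / 2)) ^ (Module.finrank ℝ (α k Df) / 2 : ℝ) *
        Real.exp ((𝔊 k Df (emb Z)).N₁ * (‖h₀‖ + ϱ * ‖w‖)) ≤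
      Gc Z * ∏ Y ∈ Df, θ * Real.exp (-((1 - 3 * δ) * κ * Dk.dj Y)))
    (hϱ : 2 ≤ ϱ) (hϱA : A₀ ≤ ϱ * A₁) :
    ‖locE G.ι G.cubes (act 1) (G.cubes X₀) - locE G.ι G.cubes (act 0) (G.cubes X₀)‖ ≤
      4 * (Real.exp 1 * G.ν * G.c₁ * G.K₀ ^ 2) * A₁ * Real.exp (-(r₁ * D.dj X₀)) := by
  refine attachedPart_locE_le_of_coresAt_pencil_families D G Gk 𝔊 hroom hm hN hq hg hO hH hscale hact hA₀ hA₁ hr₁ hb hrate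
    hsmall foot hmono hα₆.le hκ h229 hterms (fun Z hZ Df hDf => (hform Z hZ Df hDf).trans ?_) hϱ hϱA
  have hne : Df.Nonempty := nonempty_of_mem_coveringFamilies (Gk.cubes_nonempty (foot Z)) (hterms Z hDf)
  have h228 := prod_radiusLetters_le Df hne Dk.dj hθ hα₆ (fun Y _ => Dk.dj_nonneg Y) hRδ hclause
  calc Gc Z * ∏ Y ∈ Df, θ * Real.exp (-((1 - 3 * δ) * κ * Dk.dj Y))
      ≤ Gc Z * ((θ * α₆⁻¹ * Real.exp (5 * R)) *
          ∏ Y ∈ Df, (α₆ * Real.exp (-(δ * κ * Dk.dj Y)) * Real.exp (-(R * (Dk.dj Y + 5))))) :=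
        mul_le_mul_of_nonneg_left h228 (hGc Z)
    _ = Gc Z * (θ * α₆⁻¹ * Real.exp (5 * R)) *
          ∏ Y ∈ Df, (α₆ * Real.exp (-(δ * κ * Dk.dj Y)) * Real.exp (-(R * (Dk.dj Y + 5)))) := by ring
    _ ≤ (A₀ + ϱ * A₁) * ∏ Y ∈ Df, (α₆ * Real.exp (-(δ * κ * Dk.dj Y)) * Real.exp (-(R * (Dk.dj Y + 5)))) :=
        mul_le_mul_of_nonneg_right (hamp Z hZ) (Finset.prod_nonneg fun Y _ => by positivity)

end End

end Summit.QuantumFields.BalabanUV.T4Continuum.NE1p.DressedSmallFieldFamilyAmplitude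

end
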